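import Summits.Ventures.CertifiedManyBodySolver.Rows.HalfFilledTL
import Literature.MathematicalPhysics.QuantumLattice.HubbardTorusLimitSpinCorrelationSign
import Literature.MathematicalPhysics.QuantumLattice.HubbardCorrelatorCertificate
import Literature.MathematicalPhysics.QuantumLattice.HubbardHalfFilledGroundStateTorus
import Literature.MathematicalPhysics.QuantumLattice.HubbardSpinReflectionSignRule
import Literature.MathematicalPhysics.QuantumLattice.HubbardLocalSpinOperators
import Literature.MathematicalPhysics.QuantumLattice.FermionEmbedLocality
import Literature.MathematicalPhysics.QuantumLattice.FermionOperatorsSpinHermitianProofs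
import HarnessLib

/-!
# Ventures/CertifiedManyBodySolver — Rows part 30: `HalfFilledTLSpinWard` (spin-SU(2) WARD IDENTITIES in the
THERMODYNAMIC LIMIT — the `E1` equality rows for `setting: TL`)

HONEST FRAMING: first certified bounds; not a superconductivity verdict; every number certified or labelled float.

For every torus-limit half-filled ground state `ω` of the square-lattice Hubbard model (`M2.IsTLGS U ω`, Rows
part 1; more generally every `IsTorusLimitOf` limit of `L²`-particle ground states along even tori, `t ≠ 0`,
`U > 0`), every finite region `Λ ⊂ ℤ²` and EVERY local element `A ∈ 𝔄(Λ)`: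

  `ω_Λ( S⁺_Λ A − A S⁺_Λ ) = 0`,  `ω_Λ( S⁻_Λ A − A S⁻_Λ ) = 0`,  `ω_Λ( S^z_Λ A − A S^z_Λ ) = 0`

(`IsTLGS.expect_spinPlus_commutator_eq_zero` / `_spinMinus_` / `_spinZ_`), where `S^α_Λ = Σ_{x∈Λ} S^α_x` is
the total spin OF THE REGION (the Literature operators `spinPlus`, `spinMinus`, `HubbardWave0.spinZ` of the
local algebra over the ordered sites `PolySite Λ`).  These are exactly the "spin-SU(2) Ward rows"
`ω([S^α, w]) = 0` an `sdp`-TL certificate may add as equality rows (in a translation-invariant relaxation only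
the sites of `supp w` contribute to `[S^α_tot, w]`, which is `[S^α_Λ, w]` for any `Λ ⊇ supp w`).

Proof (finite volume → limit).  On the even torus the `L²`-particle ground state is unique and a singlet
(Lieb 1989, `LiebHalfFilled.hubbardTorus_finrank_groundSector_eq_one`), so `S^α_tot ψ = 0` for every
component and also for the adjoints (`spin_mulVec_eq_zero_of_spinSq_mulVec_eq_zero`); hence
`⟨ψ, [S^α_tot, B] ψ⟩ = 0` for every operator `B` (`expect_commutator_eq_zero_of_mulVec_eq_zero`).  For
`B = Γ(ι_{Λ,L}) A` an embedded local element, `[S^α_tot, Γ A] = Γ([S^α_Λ, A])`: the local charges `S^α_x`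
off the image of `Λ` are EVEN elements supported away from it and commute with `Γ A` (graded locality,
`commute_fermionEmbed_of_mem_carEvenSubalgebra`), while `Γ(S^α_Λ) = Σ_{x ∈ ι Λ} S^α_x`
(`expect_fermionEmbed_commutator_eq_zero_of_localCharge`, stated for a general family of even one-site
charges).  The identity holds for every translate of the ground state (again a ground state), hence for the
translation average, and passes to the limit (`IsTorusLimitOf.expect_eq_zero_of_eventually`).
No row is filed here (TL certificate rows are claim nodes); theorems only, no `sorry`.
[cite: LiebPRL1989, Theorem 2] [cite: EsslerEtAl2005, §2.2.5 eq. (2.66) and (2.71)–(2.73)]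
[cite: BratteliRobinsonII1997, §5.2.2] [cite: BratteliRobinsonI1987, §4.3.1]
-/

noncomputable section

namespace Summit.Ventures.CertifiedManyBodySolver

open Literature.MathematicalPhysics.QuantumLattice
open Matrix HubbardWave0 Literature.Probability.LatticeModels Filter Topology
open scoped ComplexOrder BigOperators

namespace M2

/-! ## §1 Finite volume: commutators with an annihilating charge -/

section Finite

variable {Λ Λ' : Type*} [LinearOrder Λ] [Fintype Λ] [LinearOrder Λ'] [Fintype Λ']

omit [LinearOrder Λ'] in
/-- If `S ψ = 0` and `S† ψ = 0` then `⟨ψ, (S B − B S) ψ⟩ = 0` for every `B`. [cite: Tasaki2020, App. A.3] -/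
theorem expect_commutator_eq_zero_of_mulVec_eq_zero {S : Matrix (Finset (Orb Λ')) (Finset (Orb Λ')) ℂ}
    {ψ : Fock (Orb Λ')} (hS : S *ᵥ ψ = 0) (hS' : Sᴴ *ᵥ ψ = 0)
    (B : Matrix (Finset (Orb Λ')) (Finset (Orb Λ')) ℂ) :
    star ψ ⬝ᵥ ((S * B - B * S) *ᵥ ψ) = 0 := by
  have h1 : star ψ ⬝ᵥ (S *ᵥ (B *ᵥ ψ)) = 0 := by
    rw [dotProduct_mulVec, show star ψ ᵥ* S = star (Sᴴ *ᵥ ψ) by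
      rw [star_mulVec, conjTranspose_conjTranspose], hS', star_zero, zero_dotProduct]
  rw [sub_mulVec, dotProduct_sub, ← mulVec_mulVec, ← mulVec_mulVec, hS, mulVec_zero, dotProduct_zero,
    sub_zero, h1]

/-- **`Γ(φ)` intertwines region charges with total charges, in expectation on annihilated vectors.**
Let `q_y` (`y ∈ Λ`) and `q'_x` (`x ∈ Λ'`) be one-site EVEN charges with `Γ(φ) q_y = q'_{φ y}`, and let the
total charge `Q' = Σ_x q'_x` and its adjoint annihilate `ψ`.  Then `⟨ψ, Γ(φ)(Q_Λ A − A Q_Λ) ψ⟩ = 0` for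
every `A`, `Q_Λ = Σ_y q_y` (the charges off the image commute with `Γ(φ) A` by graded locality).
[cite: BratteliRobinsonII1997, §5.2.2] -/
theorem expect_fermionEmbed_commutator_eq_zero_of_localCharge (φ : Λ ↪ Λ')
    (q : Λ → Matrix (Finset (Orb Λ)) (Finset (Orb Λ)) ℂ)
    (q' : Λ' → Matrix (Finset (Orb Λ')) (Finset (Orb Λ')) ℂ) (hq : ∀ y, fermionEmbed φ (q y) = q' (φ y))
    (hq' : ∀ x, q' x ∈ carEvenSubalgebra (orbs ({x} : Finset Λ'))) {ψ : Fock (Orb Λ')}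
    (hQ : (∑ x, q' x) *ᵥ ψ = 0) (hQ' : (∑ x, q' x)ᴴ *ᵥ ψ = 0)
    (A : Matrix (Finset (Orb Λ)) (Finset (Orb Λ)) ℂ) :
    expect (fermionEmbed φ ((∑ y, q y) * A - A * ∑ y, q y)) ψ = 0 := by
  have himg : fermionEmbed φ (∑ y, q y) = ∑ x ∈ (Finset.univ : Finset Λ).map φ, q' x := by
    rw [map_sum, Finset.sum_map]
    exact Finset.sum_congr rfl fun y _ => hq y
  have hR : Commute (∑ x ∈ ((Finset.univ : Finset Λ).map φ)ᶜ, q' x) (fermionEmbed φ A) := by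
    refine Commute.sum_left _ _ _ fun x hx => ?_
    refine commute_fermionEmbed_of_mem_carEvenSubalgebra φ A (hq' x) (disjoint_orbs ?_)
    exact Finset.disjoint_singleton_left.2 (Finset.mem_compl.1 hx)
  have hsplit : ∑ x, q' x =
      (∑ x ∈ (Finset.univ : Finset Λ).map φ, q' x) + ∑ x ∈ ((Finset.univ : Finset Λ).map φ)ᶜ, q' x :=
    (Finset.sum_add_sum_compl _ _).symm
  have hcomm : fermionEmbed φ ((∑ y, q y) * A - A * ∑ y, q y) =
      (∑ x, q' x) * fermionEmbed φ A - fermionEmbed φ A * ∑ x, q' x := by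
    rw [map_sub, map_mul, map_mul, himg, hsplit, add_mul, mul_add, hR.eq]
    abel
  rw [hcomm]
  exact expect_commutator_eq_zero_of_mulVec_eq_zero hQ hQ' _

/-- `S⁺_x` is an even element supported on the orbitals over `x`. [folklore] -/
theorem fermionSpinPlus_mem_carEvenSubalgebra (x : Λ') :
    fermionSpinPlus x ∈ carEvenSubalgebra (orbs ({x} : Finset Λ')) :=
  creation_mul_annihilation_mem_carEvenSubalgebra (orb_mem_orbs.2 (Finset.mem_singleton_self x))
    (orb_mem_orbs.2 (Finset.mem_singleton_self x))

/-- `S⁻_x` is an even element supported on the orbitals over `x`. [folklore] -/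
theorem fermionSpinMinus_mem_carEvenSubalgebra (x : Λ') :
    fermionSpinMinus x ∈ carEvenSubalgebra (orbs ({x} : Finset Λ')) :=
  creation_mul_annihilation_mem_carEvenSubalgebra (orb_mem_orbs.2 (Finset.mem_singleton_self x))
    (orb_mem_orbs.2 (Finset.mem_singleton_self x))

/-- `S^z_x` is an even element supported on the orbitals over `x`. [folklore] -/
theorem fermionSpinZ_mem_carEvenSubalgebra (x : Λ') :
    fermionSpinZ x ∈ carEvenSubalgebra (orbs ({x} : Finset Λ')) :=
  Subalgebra.smul_mem _ (Subalgebra.sub_mem _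
    (numberOp_mem_carEvenSubalgebra (orb_mem_orbs.2 (Finset.mem_singleton_self x)))
    (numberOp_mem_carEvenSubalgebra (orb_mem_orbs.2 (Finset.mem_singleton_self x)))) _

end Finite

/-! ## §2 The even torus: every half-filled ground state is a singlet, so all three Ward identities hold
for every embedded local element and every translate -/

section Torus

variable {L : ℕ} [NeZero L]

/-- **Finite-volume Ward identities.** For every `L²`-particle ground state `ψ` of the even `L × L` Hubbard
torus (`t ≠ 0`, `U > 0`), every region `Λ` pulled back injectively and every `A ∈ 𝔄(Λ)`:
`⟨ψ, Γ(S⁺_Λ A − A S⁺_Λ) ψ⟩ = ⟨ψ, Γ(S⁻_Λ A − A S⁻_Λ) ψ⟩ = ⟨ψ, Γ(S^z_Λ A − A S^z_Λ) ψ⟩ = 0`.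
[cite: LiebPRL1989, Theorem 2] [cite: BratteliRobinsonII1997, §5.2.2] -/
theorem hubbardTorus_expect_fermionEmbed_spin_commutator_eq_zero (hL : Even L) {t U : ℝ} (ht : t ≠ 0)
    (hU : 0 < U) {ψ : Fock (Orb (FermionTorus 2 L))}
    (hGS : IsGroundState (hamiltonian (fermionTorusGraph 2 L) t U) (L ^ 2) ψ) {Λ : Finset (Site 2)}
    (hInj : Set.InjOn (Torus.proj (d := 2) L) ↑Λ) (A : FermionOp Λ) :
    expect (fermionEmbed (PolySite.toTorusEmb L hInj) (spinPlus * A - A * spinPlus)) ψ = 0 ∧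
      expect (fermionEmbed (PolySite.toTorusEmb L hInj) (spinMinus * A - A * spinMinus)) ψ = 0 ∧
        expect (fermionEmbed (PolySite.toTorusEmb L hInj)
          (HubbardWave0.spinZ * A - A * HubbardWave0.spinZ)) ψ = 0 := by
  obtain ⟨hP, hM, hZ⟩ := spin_mulVec_eq_zero_of_spinSq_mulVec_eq_zero
    ((LiebHalfFilled.hubbardTorus_finrank_groundSector_eq_one hL ht hU).2 ψ
      ((LiebHalfFilled.mem_groundSector_iff (fermionTorusGraph 2 L) t U _ ψ).2 ⟨hGS.1, hGS.2.2⟩))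
  refine ⟨?_, ?_, ?_⟩
  · rw [← sum_fermionSpinPlus]
    refine expect_fermionEmbed_commutator_eq_zero_of_localCharge _ fermionSpinPlus fermionSpinPlus
      (fermionEmbed_fermionSpinPlus _) fermionSpinPlus_mem_carEvenSubalgebra ?_ ?_ A
    · rw [sum_fermionSpinPlus]; exact hP
    · rw [sum_fermionSpinPlus]; exact hM
  · rw [← sum_fermionSpinMinus]
    refine expect_fermionEmbed_commutator_eq_zero_of_localCharge _ fermionSpinMinus fermionSpinMinus
      (fermionEmbed_fermionSpinMinus _) fermionSpinMinus_mem_carEvenSubalgebra ?_ ?_ A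
    · rw [sum_fermionSpinMinus]; exact hM
    · rw [sum_fermionSpinMinus, show (spinMinus : Matrix (Finset (Orb (FermionTorus 2 L)))
        (Finset (Orb (FermionTorus 2 L))) ℂ)ᴴ = spinPlus from conjTranspose_conjTranspose _]
      exact hP
  · rw [← sum_fermionSpinZ]
    refine expect_fermionEmbed_commutator_eq_zero_of_localCharge _ fermionSpinZ fermionSpinZ
      (fermionEmbed_fermionSpinZ _) fermionSpinZ_mem_carEvenSubalgebra ?_ ?_ A
    · rw [sum_fermionSpinZ]; exact hZ
    · rw [sum_fermionSpinZ, HubbardWave0.spinZ_isHermitian.eq]; exact hZ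

end Torus

/-! ## §3 Passage to the limit -/

/-- **An eventually vanishing torus average vanishes in the limit** (uniqueness of limits).
[cite: BratteliRobinsonI1987, §4.3.1] -/
theorem IsTorusLimitOf.expect_eq_zero_of_eventually {d : ℕ} {ω : InfVolFermionState d}
    {ψ : ∀ L, Fock (Orb (FermionTorus d L))} {Ls : ℕ → ℕ} (hω : ω.IsTorusLimitOf ψ Ls)
    {Λ : Finset (Site d)} (A : FermionOp Λ)
    (h : ∀ᶠ j in atTop, torusAvgExpect (Ls j) Λ A (ψ (Ls j)) = 0) : ω.expect Λ A = 0 :=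
  tendsto_nhds_unique (hω Λ A) (tendsto_const_nhds.congr' (h.mono fun _ hj => hj.symm))

/-- **Ward identities in the torus limit (general `t ≠ 0`).** For every torus limit `ω` of `L²`-particle
ground states along even `L → ∞`, every region `Λ` and every `A ∈ 𝔄(Λ)`, the three commutators with the
region's total spin have zero expectation. [cite: LiebPRL1989, Theorem 2] [cite: BratteliRobinsonI1987, §4.3.1] -/
theorem IsTorusLimitOf.expect_spin_commutator_eq_zero {t U : ℝ} (ht : t ≠ 0) (hU : 0 < U)
    {Ls : ℕ → ℕ} (hLs : Tendsto Ls atTop atTop) (hev : ∀ j, Even (Ls j))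
    {ψ : ∀ L, Fock (Orb (FermionTorus 2 L))}
    (hψ : ∀ j, IsGroundState (hamiltonian (fermionTorusGraph 2 (Ls j)) t U) (Ls j ^ 2) (ψ (Ls j)))
    {ω : InfVolFermionState 2} (hω : ω.IsTorusLimitOf ψ Ls) (Λ : Finset (Site 2)) (A : FermionOp Λ) :
    ω.expect Λ (spinPlus * A - A * spinPlus) = 0 ∧ ω.expect Λ (spinMinus * A - A * spinMinus) = 0 ∧
      ω.expect Λ (HubbardWave0.spinZ * A - A * HubbardWave0.spinZ) = 0 := by
  obtain ⟨L₀, hL₀⟩ := exists_forall_le_injOn_proj Λ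
  have key : ∀ B : FermionOp Λ,
      (∀ (L : ℕ) [NeZero L], Even L → ∀ (hInj : Set.InjOn (Torus.proj (d := 2) L) ↑Λ)
        (φ : Fock (Orb (FermionTorus 2 L))), IsGroundState (hamiltonian (fermionTorusGraph 2 L) t U) (L ^ 2) φ →
          expect (fermionEmbed (PolySite.toTorusEmb L hInj) B) φ = 0) → ω.expect Λ B = 0 := by
    intro B hB
    refine IsTorusLimitOf.expect_eq_zero_of_eventually hω B ?_
    filter_upwards [hLs.eventually (eventually_ge_atTop (max L₀ 1))] with j hj
    have hL1 : 1 ≤ Ls j := le_trans (le_max_right _ _) hj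
    haveI : NeZero (Ls j) := ⟨by omega⟩
    have hInj : Set.InjOn (Torus.proj (d := 2) (Ls j)) ↑Λ := hL₀ _ (le_trans (le_max_left _ _) hj)
    rw [torusAvgExpect_eq, torusAvgExpectAt_of_injOn (Ls j) hInj]
    refine mul_eq_zero_of_right _ (Finset.sum_eq_zero fun v _ => ?_)
    exact hB (Ls j) (hev j) hInj _ (isGroundState_fockTranslate_mulVec t U v (hψ j))
  refine ⟨key _ fun L _ hL hInj φ hφ => ?_, key _ fun L _ hL hInj φ hφ => ?_,
    key _ fun L _ hL hInj φ hφ => ?_⟩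
  · exact (hubbardTorus_expect_fermionEmbed_spin_commutator_eq_zero hL ht hU hφ hInj A).1
  · exact (hubbardTorus_expect_fermionEmbed_spin_commutator_eq_zero hL ht hU hφ hInj A).2.1
  · exact (hubbardTorus_expect_fermionEmbed_spin_commutator_eq_zero hL ht hU hφ hInj A).2.2

/-- **TLGS(U) Ward row, `S⁺`**: `ω_Λ(S⁺_Λ A − A S⁺_Λ) = 0` for every `ω ∈ TLGS(U)`, region `Λ`, `A ∈ 𝔄(Λ)`.
[cite: LiebPRL1989, Theorem 2] [cite: EsslerEtAl2005, §2.2.5 eq. (2.66) and (2.71)–(2.73)] -/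
theorem IsTLGS.expect_spinPlus_commutator_eq_zero {U : ℝ} (hU : 0 < U) {ω : InfVolFermionState 2}
    (h : IsTLGS U ω) (Λ : Finset (Site 2)) (A : FermionOp Λ) :
    ω.expect Λ (spinPlus * A - A * spinPlus) = 0 := by
  obtain ⟨Ls, ψ, hLs, hev, hψ, -, hω⟩ := h
  exact (IsTorusLimitOf.expect_spin_commutator_eq_zero one_ne_zero hU hLs hev hψ hω Λ A).1

/-- **TLGS(U) Ward row, `S⁻`**: `ω_Λ(S⁻_Λ A − A S⁻_Λ) = 0`. [cite: LiebPRL1989, Theorem 2] -/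
theorem IsTLGS.expect_spinMinus_commutator_eq_zero {U : ℝ} (hU : 0 < U) {ω : InfVolFermionState 2}
    (h : IsTLGS U ω) (Λ : Finset (Site 2)) (A : FermionOp Λ) :
    ω.expect Λ (spinMinus * A - A * spinMinus) = 0 := by
  obtain ⟨Ls, ψ, hLs, hev, hψ, -, hω⟩ := h
  exact (IsTorusLimitOf.expect_spin_commutator_eq_zero one_ne_zero hU hLs hev hψ hω Λ A).2.1

/-- **TLGS(U) Ward row, `S^z`**: `ω_Λ(S^z_Λ A − A S^z_Λ) = 0`. [cite: LiebPRL1989, Theorem 2] -/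
theorem IsTLGS.expect_spinZ_commutator_eq_zero {U : ℝ} (hU : 0 < U) {ω : InfVolFermionState 2}
    (h : IsTLGS U ω) (Λ : Finset (Site 2)) (A : FermionOp Λ) :
    ω.expect Λ (HubbardWave0.spinZ * A - A * HubbardWave0.spinZ) = 0 := by
  obtain ⟨Ls, ψ, hLs, hev, hψ, -, hω⟩ := h
  exact (IsTorusLimitOf.expect_spin_commutator_eq_zero one_ne_zero hU hLs hev hψ hω Λ A).2.2

/-- **Symmetric form** (the shape of an `sdp` equality row): `ω_Λ(S⁺_Λ A) = ω_Λ(A S⁺_Λ)`.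
[cite: LiebPRL1989, Theorem 2] -/
theorem IsTLGS.expect_spinPlus_mul_eq {U : ℝ} (hU : 0 < U) {ω : InfVolFermionState 2}
    (h : IsTLGS U ω) (Λ : Finset (Site 2)) (A : FermionOp Λ) :
    ω.expect Λ (spinPlus * A) = ω.expect Λ (A * spinPlus) := by
  have h0 := h.expect_spinPlus_commutator_eq_zero hU Λ A
  rwa [map_sub, sub_eq_zero] at h0

end M2

end Summit.Ventures.CertifiedManyBodySolver
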